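import Summits.ResolutionOfSingularities.ResolutionOfSingularities.Theorems.MarkedTransferCampaignW46ThreefoldsGammaFreeGlobalCartierStep
import Literature.AlgebraicGeometry.Resolution.PrimeDivisorIdeals
import Literature.AlgebraicGeometry.Resolution.BlowupChartMembership
import Literature.AlgebraicGeometry.Resolution.KollarMaxContactChartsFieldChange
import Literature.AlgebraicGeometry.Resolution.SubschemeRegularStalks
import Literature.AlgebraicGeometry.Resolution.RegularLocalOrderValuation
import HarnessLib

/-!
# [OURS · L1 W4.6 rung (ii) ladder support] THE ORDER LAW ON A REGULAR CARTIER CENTRE under the identity step —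
# `ord_y (I : 𝓘_D^m) + m = ord_y I` for `y ∈ D` (brick B1 block 2 for the `d = 2` rung, RUNG MAP (ii-2))

Cell res-hironaka, LADDER-RESOLUTION rung L (D-0089), slot W4.6, rung (ii) dimension ladder (res-L1-type-o1 p496755); seat
res-L1-s46-pv-10 = res-D-pv-047, SUPPORT for the `d = 2` rung held by res-L1-s46-pv-11 = res-D-pv-049 («GO on BOTH blocks»,
STATUS 2026-08-27T04:57:59Z). Host route MarkedTransfer, host item `HypersurfaceOrderReductionDimLeThree`
(stmt-ResolutionOfSingularities-16156), `--kind proof --supports … --as helper`. Everything is OURS; nothing is a statement of the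
manuscript; no typed `Hironaka2017` candidate and no `Literature.…` named FACT enters (only proved tree lemmas). AI-written; weaker
than expert review.

## What is proved

* Ring level, `R` a regular local ring, `f ∈ 𝔪 ∖ 𝔪²` (so `ord f = 1`, `adicOrder_eq_one_of_mem_of_not_mem_sq`):
  `span_singleton_pow_mul_le_pow_iff` — `(f)^m · J ⊆ 𝔪^{n+m} ↔ J ⊆ 𝔪^n` (the order function of a regular local ring is a
  valuation, tree `adicOrder_mul`, Zariski–Samuel VIII §1 Thm. 1).
* `CampaignW46.idealOrder_step_of_cartierCentre` — on a locally Noetherian scheme `X`, for a closed `D` with `𝓘_D` an effective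
  Cartier divisor and `V(𝓘_D)` REGULAR, an ideal `I ⊆ 𝓘_D^m`, and a point `y ∈ D` with `𝒪_{X,y}` regular: the controlled transform
  `J₁ = (I : 𝓘_D^m)` of the identity blow-up along `D` (`step_of_cartierCentre`, block 1, p498518) satisfies
  **`ord_y J₁ + m = ord_y I`**. Route: `𝓘_{D,y} = (f)` with `f` a nonzerodivisor (`IsEffectiveCartier.exists_stalkIdeal_eq_span`),
  `f ∈ 𝔪_y` (`y ∈ D`), `f ∉ 𝔪_y²` because `𝒪_{X,y}/(f) = 𝒪_{D,y}` is regular (`isRegularLocalRing_stalk_quotient_stalkIdeal`,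
  `notMem_sq_of_isRegularLocalRing_quotient`, Matsumura 14.2), `𝓘_D^m · J₁ = I` (`pow_mul_colon_eq_of_le_of_isEffectiveCartier`,
  BGMW Lemma 3.2.1) read on stalks as `(f)^m · J₁,y = I_y`, and the ring-level lemma.
* `CampaignW46.le_idealOrder_step_of_cartierCentre` — the inclusion `I ⊆ 𝓘_D^m` gives the permissibility hypothesis
  `∀ y ∈ D, m ≤ ord_y I` of block 1 (tree `le_idealOrder_of_le_vanishingIdeal_pow` pattern, re-proved here in three lines to keep the
  import light).
* `CampaignW46.idealOrder_step_of_primeDivisor` — the PRIME-DIVISOR form the `d = 2` rung consumes: `X` regular integral locally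
  Noetherian, `ζ` a point of codimension one (`Order.coheight ζ = 1`) whose closure `E = cl{ζ}` has regular subscheme, `I` an ideal
  with `m ≤ ord_ζ I`; then `I ⊆ 𝓘_E^m` (tree `le_primeDivisorIdeal_pow_of_isRegular`, Cossart–Piltant 2008 proof of Prop. 4.2), `𝓘_E`
  is effective Cartier (tree `isEffectiveCartier_primeDivisorIdeal_of_isRegular`), the identity step along `E` is permissible for
  `(I, m)` and `ord_y (I : 𝓘_E^m) + m = ord_y I` at EVERY `y ∈ E`; off `E` the stalks are unchanged (block 1).

References: block 1 `…GammaFreeGlobalCartierStep.lean` (p498518), `…GammaFreeGlobalCurves.lean` (p497830, the `D = {x}` DVR case); tree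
`Resolution/PrimeDivisorIdeals.lean`, `Resolution/BlowupChartMembership.lean`, `Resolution/KollarMaxContactChartsFieldChange.lean`
(`notMem_sq_of_isRegularLocalRing_quotient`), `Resolution/SubschemeRegularStalks.lean`, `Resolution/RegularLocalOrderValuation.lean`,
`Resolution/ColonIdealSheafFG.lean`. H. Hironaka, ms. 2017-03-23, §2.1 p.4, Def. 2.1 p.5 — scope only, under adjudication, not
cited as fact. [Hironaka2017]
-/

noncomputable section

set_option linter.dupNamespace false -- mandated namespace of this single-conjunct summit

open CategoryTheory AlgebraicGeometry TopologicalSpace IsLocalRing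

namespace Summit.ResolutionOfSingularities.ResolutionOfSingularities.Theorems

namespace CampaignW46

open Literature.AlgebraicGeometry.Resolution
open Scheme.IdealSheafData

universe u

/-! ## §1 Ring level: multiplying by `f^m`, `f ∈ 𝔪 ∖ 𝔪²`, shifts `𝔪`-adic orders by exactly `m` in a regular local ring -/

section Ring

variable {R : Type u} [CommRing R]

/-- In a local ring, `f ∈ 𝔪 ∖ 𝔪²` has `𝔪`-adic order exactly `1`. [cite: ZariskiSamuel1960, Vol. II Ch. VIII §1] -/
theorem adicOrder_eq_one_of_mem_of_not_mem_sq [IsLocalRing R] {f : R} (h1 : f ∈ maximalIdeal R)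
    (h2 : f ∉ maximalIdeal R ^ 2) : adicOrder f = 1 := by
  refine le_antisymm ?_ ((le_adicOrder_iff f 1).mpr (by rwa [pow_one]))
  by_contra hlt
  have h2' : ((2 : ℕ) : ℕ∞) ≤ adicOrder f := by
    rw [not_le] at hlt
    cases h : adicOrder f with
    | top => exact le_top
    | coe k =>
      rw [h] at hlt
      have hk : 1 < k := by exact_mod_cast hlt
      exact_mod_cast hk
  exact h2 ((le_adicOrder_iff f 2).mp h2')

/-- **`(f)^m · J ⊆ 𝔪^{n+m} ↔ J ⊆ 𝔪^n`** in a regular local ring, for `f ∈ 𝔪 ∖ 𝔪²` (the order function is additive,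
`adicOrder_mul`: `ord(f^m x) = m + ord x`). [cite: ZariskiSamuel1960, Vol. II Ch. VIII §1 Thm. 1] -/
theorem span_singleton_pow_mul_le_pow_iff [IsRegularLocalRing R] {f : R} (h1 : f ∈ maximalIdeal R)
    (h2 : f ∉ maximalIdeal R ^ 2) (J : Ideal R) (m n : ℕ) :
    Ideal.span {f} ^ m * J ≤ maximalIdeal R ^ (n + m) ↔ J ≤ maximalIdeal R ^ n := by
  have hordf : adicOrder f = 1 := adicOrder_eq_one_of_mem_of_not_mem_sq h1 h2
  have hordfm : adicOrder (f ^ m) = m := by rw [adicOrder_pow, hordf, mul_one]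
  constructor
  · intro h x hx
    have hfx : f ^ m * x ∈ maximalIdeal R ^ (n + m) :=
      h (Ideal.mul_mem_mul (Ideal.pow_mem_pow (Ideal.mem_span_singleton_self f) m) hx)
    have hle : ((n + m : ℕ) : ℕ∞) ≤ adicOrder (f ^ m * x) := (le_adicOrder_iff _ _).mpr hfx
    rw [adicOrder_mul, hordfm] at hle
    -- `n + m ≤ m + ord x` in `ℕ∞` gives `n ≤ ord x`
    have hn : (n : ℕ∞) ≤ adicOrder x := by
      cases h' : adicOrder x with
      | top => exact le_top
      | coe k =>
        rw [h'] at hle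
        have : n + m ≤ m + k := by exact_mod_cast hle
        exact_mod_cast (by omega : n ≤ k)
    exact (le_adicOrder_iff x n).mp hn
  · intro h
    calc Ideal.span {f} ^ m * J ≤ maximalIdeal R ^ m * maximalIdeal R ^ n :=
          Ideal.mul_mono (Ideal.pow_right_mono ((Ideal.span_singleton_le_iff_mem _).mpr h1) m) h
      _ = maximalIdeal R ^ (n + m) := by rw [← pow_add, Nat.add_comm]

end Ring

/-! ## §2 The order law on a regular Cartier centre under the identity step -/

section Scheme

variable {X : Scheme.{u}}

/-- If `I ⊆ 𝓘_D^m` then `m ≤ ord_y I` at every `y ∈ D` — the permissibility hypothesis of `step_of_cartierCentre`.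
[cite: GortzWedhorn2020, Prop. 13.91] -/
theorem le_idealOrder_step_of_cartierCentre (D : Closeds X) {I : X.IdealSheafData} {m : ℕ}
    (hle : I ≤ vanishingIdeal D ^ m) : ∀ y ∈ (D : Set X), (m : ℕ∞) ≤ idealOrder I y := by
  intro y hy
  rw [le_idealOrder_iff]
  have hys : y ∈ ((vanishingIdeal D).support : Set X) := by rw [coe_support_vanishingIdeal]; exact hy
  calc stalkIdeal I y ≤ stalkIdeal (vanishingIdeal D ^ m) y := stalkIdeal_mono hle y
    _ = stalkIdeal (vanishingIdeal D) y ^ m := stalkIdeal_pow _ m y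
    _ ≤ maximalIdeal (X.presheaf.stalk y) ^ m := Ideal.pow_right_mono ((mem_support_iff_stalkIdeal_le _ y).mp hys) m

/-- **THE ORDER LAW ON THE CENTRE.** Let `X` be locally Noetherian, `D ⊆ X` closed with `𝓘_D` an effective Cartier divisor and
`V(𝓘_D)` regular, `I ⊆ 𝓘_D^m`, and `y ∈ D` with `𝒪_{X,y}` regular. For the controlled transform `J₁ = (I : 𝓘_D^m)` of the
identity blow-up along `D`: `ord_y J₁ + m = ord_y I`. [folklore] -/
theorem idealOrder_step_of_cartierCentre [IsLocallyNoetherian X] (D : Closeds X)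
    (hreg : Scheme.IsRegular (vanishingIdeal D).subscheme) (hcart : IsEffectiveCartier (vanishingIdeal D))
    {I : X.IdealSheafData} {m : ℕ} (hle : I ≤ vanishingIdeal D ^ m) {y : X} (hy : y ∈ (D : Set X))
    [IsRegularLocalRing (X.presheaf.stalk y)] :
    idealOrder (controlledTransform (𝟙 X) (vanishingIdeal D) I m) y + m = idealOrder I y := by
  set J₁ := controlledTransform (𝟙 X) (vanishingIdeal D) I m with hJ₁
  -- the local equation `f` of `D` at `y`: a nonzerodivisor in `𝔪_y ∖ 𝔪_y²`
  obtain ⟨f, hf0, hf⟩ := hcart.exists_stalkIdeal_eq_span y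
  have hys : y ∈ (vanishingIdeal D).support := by
    rw [← SetLike.mem_coe, coe_support_vanishingIdeal]; exact hy
  have hf1 : f ∈ maximalIdeal (X.presheaf.stalk y) := by
    have h := (mem_support_iff_stalkIdeal_le _ y).mp hys
    rw [hf] at h
    exact h (Ideal.mem_span_singleton_self f)
  have hregq : IsRegularLocalRing (X.presheaf.stalk y ⧸ Ideal.span {f}) := by
    have h := isRegularLocalRing_stalk_quotient_stalkIdeal hreg hys
    rwa [hf] at h
  have hf2 : f ∉ maximalIdeal (X.presheaf.stalk y) ^ 2 :=
    notMem_sq_of_isRegularLocalRing_quotient hf1 (nonZeroDivisors.ne_zero hf0)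
  -- `𝓘_D^m · J₁ = I`, read on the stalk at `y`: `(f)^m · J₁,y = I_y`
  have hglob : vanishingIdeal D ^ m * J₁ = I := by
    rw [hJ₁, controlledTransform, comap_id, comap_id]
    exact pow_mul_colon_eq_of_le_of_isEffectiveCartier hcart hle
  have hloc : Ideal.span {f} ^ m * stalkIdeal J₁ y = stalkIdeal I y := by
    rw [← hf, ← stalkIdeal_pow, ← stalkIdeal_mul, hglob]
  -- compare orders degree by degree
  refine ENat.eq_of_forall_natCast_le_iff fun k => ?_
  have hmI : (m : ℕ∞) ≤ idealOrder I y := le_idealOrder_step_of_cartierCentre D hle y hy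
  by_cases hkm : k ≤ m
  · constructor
    · intro _; exact le_trans (by exact_mod_cast hkm) hmI
    · intro _; exact le_trans (by exact_mod_cast hkm) le_add_self
  · obtain ⟨n, rfl⟩ : ∃ n, k = n + m := ⟨k - m, by omega⟩
    have key : ((n + m : ℕ) : ℕ∞) ≤ idealOrder I y ↔ (n : ℕ∞) ≤ idealOrder J₁ y := by
      rw [le_idealOrder_iff, le_idealOrder_iff, ← hloc]
      exact span_singleton_pow_mul_le_pow_iff hf1 hf2 _ m n
    rw [key, Nat.cast_add]
    -- `n + m ≤ a + m ↔ n ≤ a` in `ℕ∞`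
    constructor
    · intro h
      cases ha : idealOrder J₁ y with
      | top => exact le_top
      | coe a =>
        rw [ha] at h
        have : n + m ≤ a + m := by exact_mod_cast h
        exact_mod_cast (by omega : n ≤ a)
    · intro h
      exact add_le_add_left h _

/-- **THE PRIME-DIVISOR FORM (the shape the `d = 2` rung consumes).** Let `X` be a regular integral locally Noetherian scheme,
`ζ` a point of codimension one with `E = cl{ζ}` having regular subscheme (`𝓘_E = primeDivisorIdeal ζ`), and `I` an ideal with
`m ≤ ord_ζ I`. Then `I ⊆ 𝓘_E^m` (Cossart–Piltant), the identity step along `E` is a sequence of permissible blowing-ups of length one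
for `(I, m)` with last transform `J₁ = (I : 𝓘_E^m)`, and `ord_y J₁ + m = ord_y I` at every `y` with `ζ ⤳ y`, while `J₁,y = I_y` off
`E`. [cite: CossartPiltant2008, proof of Prop. 4.2] -/
theorem idealOrder_step_of_primeDivisor [IsIntegral X] [IsLocallyNoetherian X] (hX : Scheme.IsRegular X) {ζ : X}
    (hζ : Order.coheight ζ = 1) (hregE : Scheme.IsRegular (primeDivisorIdeal ζ).subscheme) {I : X.IdealSheafData}
    {m : ℕ} (hm : (m : ℕ∞) ≤ idealOrder I ζ) :
    IsPermissibleBlowupSeq I m (𝟙 X) (controlledTransform (𝟙 X) (primeDivisorIdeal ζ) I m) ∧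
      (∀ y : X, ζ ⤳ y → idealOrder (controlledTransform (𝟙 X) (primeDivisorIdeal ζ) I m) y + m = idealOrder I y) ∧
      (∀ y : X, ¬ ζ ⤳ y → stalkIdeal (controlledTransform (𝟙 X) (primeDivisorIdeal ζ) I m) y = stalkIdeal I y) ∧
      I ≤ controlledTransform (𝟙 X) (primeDivisorIdeal ζ) I m := by
  have hle : I ≤ primeDivisorIdeal ζ ^ m :=
    le_primeDivisorIdeal_pow_of_isRegular hX hζ ((le_idealOrder_iff I ζ m).mp hm)
  have hcart : IsEffectiveCartier (primeDivisorIdeal ζ) := isEffectiveCartier_primeDivisorIdeal_of_isRegular hX hζ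
  let E : Closeds X := ⟨closure {ζ}, isClosed_closure⟩
  have hE : primeDivisorIdeal ζ = vanishingIdeal E := rfl
  have hmem : ∀ y : X, y ∈ (E : Set X) ↔ ζ ⤳ y := fun y => (specializes_iff_mem_closure).symm
  obtain ⟨hseq, -, hoff, hleJ⟩ :=
    step_of_cartierCentre E hregE hcart (le_idealOrder_step_of_cartierCentre E hle)
  refine ⟨hseq, fun y hy => ?_, fun y hy => hoff y (fun h => hy ((hmem y).mp h)), hleJ⟩
  haveI := hX y
  exact idealOrder_step_of_cartierCentre E hregE hcart hle ((hmem y).mpr hy)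

end Scheme

end CampaignW46

end Summit.ResolutionOfSingularities.ResolutionOfSingularities.Theorems

end
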